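import Literature.AnabelianGeometry.SemiGraphs.FiniteEtaleCoveringGlobal
import Literature.AnabelianGeometry.SemiGraphs.CoveringOfObjectProofs
import Literature.AnabelianGeometry.SemiGraphs.CoveringStarIso
import Literature.AnabelianGeometry.SemiGraphs.CoveringEssSurjIso

/-!
# [SemiAnbd] Def. 2.2 (i), existence with the GLOBAL clause — proof (`exists_finiteEtaleCovering_global_holds`)

Mochizuki, *Semi-graphs of anabelioids*, Publ. RIMS **42** (2006) 221–322, §2 p. 23
[cite: MochizukiSemiAnbd2006, Def. 2.2(i) p.23]: "`B'` itself arises naturally as the `B(−)` of some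
semi-graph of anabelioids `𝒢'` equipped with a morphism `𝒢' → 𝒢`".  For an object `A` of `B(𝒢)` the
covering `coveringHomCan A : 𝒢_A → 𝒢` (`CoveringOfObject.lean`, `CoveringHomCanonical.lean`) is the finite
étale covering attached to `A` locally (`coveringHomCan_isFiniteEtaleCoveringOf`) AND globally:
`B(𝒢)_{/A} ⥤ B(𝒢_A)` (`toCovering A`) is an equivalence (`toCovering_isEquivalence`: faithful, full,
essentially surjective — `CoveringFaithful`, `CoveringFull`, `CoveringEssSurjIso`) with
`φ^* ≅ (A × −) ⋙ toCovering A` (`pullbackFunctorIsoStarComp`, `CoveringStarIso`).  Hence the cell's named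
fact `exists_finiteEtaleCovering_global` (`FiniteEtaleCoveringGlobal.lean`, abc-iut-L3-d3) HOLDS.
-/

namespace Literature.AnabelianGeometry.SemiGraphs

namespace SemiGraphOfAnabelioids

open CategoryTheory CategoryTheory.Limits

universe v₁ u₁ u

variable {𝒢 : SemiGraphOfAnabelioids.{v₁, u₁, u}}

/-- **`𝒢_A → 𝒢` is the covering attached to `A` GLOBALLY**: `B(𝒢)_{/A} ≃ B(𝒢_A)` with `φ^* ≅ (A × −)`
([SemiAnbd] p. 23 "`B' = B(𝒢)_{G'}` arises as `B(𝒢')`"). [cite: MochizukiSemiAnbd2006, Def. 2.2(i) p.23] -/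
theorem BObj.coveringHomCan_isGlobalCoveringOf (A : 𝒢.BObj) : A.coveringHomCan.IsGlobalCoveringOf A := by
  haveI := hasBinaryProducts_bObj 𝒢
  exact ⟨inferInstance, A.toCovering, A.toCovering_isEquivalence, ⟨A.pullbackFunctorIsoStarComp⟩⟩

/-- **[SemiAnbd] Def. 2.2 (i), existence of the finite étale covering attached to an object of `B(𝒢)`,
local AND global clauses** — the named fact `exists_finiteEtaleCovering_global` holds: take `𝒢' := 𝒢_A`,
`φ := coveringHomCan A`. (The hypotheses "connected, with a vertex" are not used by the construction.)
[cite: MochizukiSemiAnbd2006, Def. 2.2(i) p.23] -/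
theorem exists_finiteEtaleCovering_global_holds : exists_finiteEtaleCovering_global.{v₁, u₁, u} :=
  fun _ _ _ A => ⟨A.coveringGraph, A.coveringHomCan, A.coveringHomCan_isFiniteEtaleCoveringOf,
    A.coveringHomCan_isGlobalCoveringOf⟩

end SemiGraphOfAnabelioids

end Literature.AnabelianGeometry.SemiGraphs
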